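import Mathlib.Analysis.SpecialFunctions.Complex.Log
import Mathlib.Analysis.SpecialFunctions.Exponential
import Mathlib.Analysis.Calculus.IteratedDeriv.Lemmas
import Mathlib.RingTheory.Algebraic.Basic
import Mathlib.FieldTheory.Minpoly.Field
import Literature.NumberTheory.Transcendental.PeriodsWave0Proofs
import Literature.Barriers.Schanuel.AxiomsDoNotForceSchanuel
import Literature.Barriers.Schanuel.NesterenkoModularScope
import Literature.Barriers.Schanuel.AlgebraicIndependenceOfLogarithms
import HarnessLib
import HarnessLib.Audit

/-!
# Barrier (Schanuel): the Siegel–Shidlovskii `E`-function method — numerical = functional transcendence degree, but only at ALGEBRAIC arguments; `e + π`, `eπ`, `e^e`, `π^e` are believed not to be `E`-values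

`Literature/Barriers/Schanuel/EFunctionValuesAtAlgebraicPoints.lean` — barrier catalogue entry
(D-0021) for the summit `Schanuel` (`Summits/Schanuel/Schanuel/Statement.lean`;
`Literature.Periods.SchanuelConjecture = ∀ n, Literature.Transcend.SchanuelRank n` by `Iff.rfl`), found while
sourcing the seed "o-minimality / Ax–Schanuel gives functional not numerical statements": the
one classical method in which functional algebraic independence DOES yield numerical algebraic
independence — Siegel's `E`-functions (Siegel 1929, Shidlovskii 1956; Beukers 2006, André
2014) — has as its printed scope the values `F(α)` of `E`-functions at ALGEBRAIC points `α`,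
which contains Lindemann–Weierstrass (`x̄ ∈ ℚ̄ⁿ` in Schanuel's conjecture) and, in print, is
believed not to contain `e + π`, `eπ`, `e^e`, `π^e` — transcendence statements that Schanuel's
conjecture implies (PROVED below for `e + π`, `eπ`, `e^e`).

## What the source prints (verified on the page) [Rivoal2024] (T. Rivoal, *Les E-fonctions et G-fonctions de Siegel*, Journées X-UPS 2019, published 2024)

* §5, p. 226: "Si l'on veut généraliser les résultats de transcendance d'Hermite, Lindemann et
  Weierstrass à d'autres fonctions que l'exponentielle ou le logarithme, on se heurte rapidement
  à deux obstacles : (1) L'absence de formules explicites pour les approximants de Padé … (2)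
  L'absence d'une équation fonctionnelle telle que `e^{x+y} = e^x e^y`, qui est cruciale pour
  passer de résultats d'irrationalité/indépendance linéaire … à des résultats d'indépendance
  algébrique sur `ℚ̄`. Siegel [158] a introduit en 1929 deux classes de séries entières, les
  `E`-fonctions et les `G`-fonctions, qui permettent de lever ces deux obstacles dans une certaine
  mesure … disons d'ores et déjà que l'on pense que la constante d'Euler `γ`, `Γ(1/5)`,
  `ln(π)`, `δ`, `e + π`, `eπ`, `e^e` et `π^e` ne sont des valeurs en un point algébrique ni d'une
  `E`-fonction ni d'une `G`-fonction. Il est donc malheureusement probable qu'aucun des théorèmes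
  diophantiens cités ici sur ces fonctions ne s'applique à ces nombres individuellement."
* Définition 5.2 (p. 227): "Une `E`-fonction au sens strict est une série entière
  `F(z) = ∑ (aₙ/n!) zⁿ ∈ ℚ̄[[z]]` telle que (i) `F(z)` est solution d'une équation différentielle
  linéaire non nulle à coefficients dans `ℚ̄(z)`. (ii) Il existe une constante `C > 0` telle que
  pour tout `σ ∈ Gal(ℚ̄/ℚ)` et tout `n ≥ 0`, on ait `|σ(aₙ)| ≤ C^{n+1}`. (iii) Il existe une suite
  d'entiers `(Dₙ)` et une constante `D > 0` telles que pour tous entiers `0 ≤ m ≤ n`, on ait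
  `Dₙ a_m ∈ O_ℚ̄` et `1 ≤ |Dₙ| ≤ D^{n+1}`." "Offenbar ist die Exponentialfunktion eine
  E-Funktion" (Siegel, quoted p. 227); "Tous les exemples connus de `E`-fonctions sont des
  `E`-fonctions au sens strict" (p. 227).
* Théorème 5.10 (Siegel–Shidlovskii, p. 234): "Soit `Y(z) = ᵗ(F₁(z), …, Fₙ(z))` un vecteur de
  `E`-fonctions de `ℚ̄[[z]]` solution d'un système différentiel `Y′(z) = A(z)Y(z)` avec
  `A(z) ∈ M_{n×n}(ℚ̄(z))`. Soit `T(z)` un dénominateur commun des coefficients de `A(z)`, de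
  degré minimal. Alors, pour tout `α ∈ ℚ̄` tel que `αT(α) ≠ 0`,
  `deg tr_{ℚ̄(z)} ℚ̄(z)(F₁(z), …, Fₙ(z)) = deg tr_ℚ̄ ℚ̄(F₁(α), …, Fₙ(α))`." "Ce théorème est bien
  une généralisation de celui de Lindemann–Weierstrass … En prenant `α = 1` …
  `deg tr_ℚ̄ ℚ̄(e^{α₁}, …, e^{αₙ}) = n`" (p. 234); Théorème 5.19 (linear independence version)
  and footnote 11 (p. 240): "L'énoncé optimal … a été obtenu en 2006 par Beukers [23] pour les
  `E`-fonctions au sens strict, et par André [10] en 2014 pour les `E`-fonctions au sens large";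
  Théorème 5.21 (homogeneous version, p. 241).

## Lean rendering

* `eSeries a z = ∑ aₙ zⁿ/n!`; `IsStrictEFunction a` is Définition 5.2 with `σ(aₙ)` rendered as
  the complex roots of `minpoly ℚ aₙ` (the conjugates of `aₙ`), `O_ℚ̄` as `IsIntegral ℤ`, and (i)
  as a non-trivial linear ODE with polynomial coefficients in `ℚ̄[z]` (clearing denominators);
  `eValues` = values of strict `E`-functions at algebraic points.
* `siegelShidlovskii_algIndep` (named fact; it IS the catalogue declaration
  `EFunctionValuesAtAlgebraicPoints`, `eFunctionValuesAtAlgebraicPoints_iff`) is the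
  algebraic-independence CONSEQUENCE of Théorème 5.10 (`deg tr = n` on both sides): if
  `(z, F₁, …, Fₙ)` are algebraically independent over `ℚ̄ = algebraicClosure ℚ ℂ` as functions
  (Mathlib's `AlgebraicIndependent (algebraicClosure ℚ ℂ) (Fin.cons id F)` in the algebra
  `ℂ → ℂ`) then `F₁(α), …, Fₙ(α)` are algebraically independent over `ℚ̄` as numbers
  (`AlgebraicIndependent (algebraicClosure ℚ ℂ) (F · α)`), for `α ∈ ℚ̄`, `αT(α) ≠ 0`.
* PROVED supporting theorems: `exp` is a strict `E`-function (`isStrictEFunction_exp`,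
  `eSeries_one_eq_exp`), so `e ∈ eValues` (the method reaches Hermite/Lindemann–Weierstrass);
  and the summit implies the transcendence of `e + π`, `eπ`
  (`transcendental_exp_add_pi_of_schanuel`, `transcendental_exp_mul_pi_of_schanuel`, via
  `expOnePiAlgebraicIndependent_of_schanuel`) and of `e^e` (`transcendental_exp_exp_of_schanuel`,
  tuple `(1, e)`), i.e. exactly instances printed as outside the method's expected reach —
  the printed exclusions being the conjectural named statements `ExpAddPiNotEValue`,
  `ExpMulPiNotEValue`, `ExpExpNotEValue`, `PiPowExpNotEValue`.
* Registered OPEN statements (verdict clean-up, 2026-08-15): the four printed exclusions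
  `ExpAddPiNotEValue`, `ExpMulPiNotEValue`, `ExpExpNotEValue`, `PiPowExpNotEValue` are OPEN
  CONJECTURES in the sense of CONVENTIONS §4 (docstrings `OPEN CONJECTURE — … [status: open]`;
  names and statements unchanged, each has in-tree users), not named-fact debt: by the PROVED
  reductions of `EFunctionValuesAtAlgebraicPointsProofs.lean` (`ℚ̄ ⊆ eValues`, hence
  `w ∉ eValues → Transcendental ℚ w`) each of them implies the transcendence — a fortiori the
  irrationality — of `e + π`, `eπ`, `e^e`, `π^e` respectively, which the source prints as unknown:
  "On ne sait pas montrer non plus que les nombres `e + π` et `eπ` sont irrationnels … on ne sait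
  rien de `π^e`, `π^π` ou `e^e`" (§4 p. 204), "plusieurs problèmes classiques encore ouverts, dont
  la transcendance de `e + π` et de `eπ`" (§8 Problème 10, p. 289). No `_holds` is to be expected
  for any of the four.

## References

* [Rivoal2024] T. Rivoal, *Les E-fonctions et G-fonctions de Siegel*, in: Périodes et
  transcendance, Journées mathématiques X-UPS 2019, Éditions de l'École polytechnique (2024),
  doi:10.5802/xups.2019-03: §5 p. 226, Définition 5.2, Théorèmes 5.10, 5.19–5.21, footnote 11;
  for the open status of the four exclusions also §4 p. 204, §8 Problème 6 (p. 286: the set `𝐄`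
  of `E`-values) and Problème 10 (p. 289).
* C. L. Siegel, *Über einige Anwendungen diophantischer Approximationen* (1929); A. B.
  Shidlovskii (1959); F. Beukers, Ann. of Math. 163 (2006); Y. André (2014) — cited through
  [Rivoal2024].
-/

noncomputable section

open Complex Polynomial
open scoped Nat

namespace Literature.Barriers.Schanuel

/-! ### 1. Strict `E`-functions and their values at algebraic points -/

/-- The power series `F(z) = ∑ₙ aₙ zⁿ / n!` attached to a coefficient sequence `a`.
[cite: Rivoal2024, Définition 5.2] -/
def eSeries (a : ℕ → ℂ) (z : ℂ) : ℂ :=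
  ∑' n : ℕ, a n * z ^ n / (n ! : ℂ)

/-- **Strict `E`-function** (Siegel; Rivoal Déf. 5.2) as a predicate on the coefficients `aₙ`:
`aₙ ∈ ℚ̄`; (i) `F = eSeries a` satisfies a non-trivial linear differential equation with
coefficients in `ℚ̄[z]`; (ii) all conjugates of `aₙ` have absolute value `≤ C^{n+1}`; (iii)
common denominators `1 ≤ Dₙ ≤ D^{n+1}` with `Dₙ a_m` an algebraic integer for `m ≤ n`.
[cite: Rivoal2024, Définition 5.2] -/
def IsStrictEFunction (a : ℕ → ℂ) : Prop :=
  (∀ n, IsAlgebraic ℚ (a n)) ∧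
  (∃ (m : ℕ) (P : Fin (m + 1) → Polynomial ℂ), P ≠ 0 ∧ (∀ j k, IsAlgebraic ℚ ((P j).coeff k)) ∧
    ∀ z : ℂ, ∑ j : Fin (m + 1), (P j).eval z * iteratedDeriv j (eSeries a) z = 0) ∧
  (∃ C : ℝ, 0 < C ∧ ∀ n, ∀ b ∈ (minpoly ℚ (a n)).rootSet ℂ, ‖b‖ ≤ C ^ (n + 1)) ∧
  (∃ (D : ℕ → ℤ) (D₀ : ℝ), 0 < D₀ ∧ ∀ n, 1 ≤ D n ∧ (D n : ℝ) ≤ D₀ ^ (n + 1) ∧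
    ∀ m ≤ n, IsIntegral ℤ ((D n : ℂ) * a m))

/-- The set of **`E`-values**: values `F(α)` of strict `E`-functions at algebraic points `α`
("valeurs en un point algébrique d'une `E`-fonction"). [cite: Rivoal2024, §5 p. 226] -/
def eValues : Set ℂ :=
  {w | ∃ (a : ℕ → ℂ) (α : ℂ), IsStrictEFunction a ∧ IsAlgebraic ℚ α ∧ eSeries a α = w}

/-! ### 2. The Siegel–Shidlovskii theorem (named fact) -/

/-- **Siegel–Shidlovskii (Rivoal Thm. 5.10), algebraic-independence form** (named fact; the
printed theorem is the EQUALITY of transcendence degrees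
`deg tr_{ℚ̄(z)} ℚ̄(z)(F₁, …, Fₙ) = deg tr_ℚ̄ ℚ̄(F₁(α), …, Fₙ(α))`, of which this is the case of
maximal degree `n`): let `F₁, …, Fₙ` be strict `E`-functions with
`T(z) Fᵢ′(z) = ∑ⱼ Bᵢⱼ(z) Fⱼ(z)` for polynomials `T`, `Bᵢⱼ` over `ℚ̄` (i.e. `Y′ = AY`,
`A = B/T ∈ M_n(ℚ̄(z))`; the printed `T` is a common denominator of `A` of minimal degree, which
divides any such `T`). If `(z, F₁, …, Fₙ)` are algebraically independent over
`ℚ̄ = algebraicClosure ℚ ℂ` as functions (Mathlib's `AlgebraicIndependent` in the `ℚ̄`-algebra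
`ℂ → ℂ`, i.e. `deg tr_{ℚ̄(z)} = n`), then for every algebraic `α` with `αT(α) ≠ 0` the numbers
`F₁(α), …, Fₙ(α)` are algebraically independent over `ℚ̄`. Users take
`(h : siegelShidlovskii_algIndep)`. [cite: Rivoal2024, Théorème 5.10] -/
def siegelShidlovskii_algIndep : Prop :=
  ∀ (n : ℕ) (a : Fin n → ℕ → ℂ), (∀ i, IsStrictEFunction (a i)) →
    ∀ (T : Polynomial ℂ) (B : Matrix (Fin n) (Fin n) (Polynomial ℂ)),
      (∀ k, IsAlgebraic ℚ (T.coeff k)) → (∀ i j k, IsAlgebraic ℚ ((B i j).coeff k)) →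
      (∀ i z, T.eval z * deriv (eSeries (a i)) z = ∑ j, (B i j).eval z * eSeries (a j) z) →
      AlgebraicIndependent (algebraicClosure ℚ ℂ)
        (Fin.cons (id : ℂ → ℂ) fun i => eSeries (a i) : Fin (n + 1) → ℂ → ℂ) →
      ∀ α : ℂ, IsAlgebraic ℚ α → α ≠ 0 → T.eval α ≠ 0 →
        AlgebraicIndependent (algebraicClosure ℚ ℂ) fun i => eSeries (a i) α

/-! ### 3. The exponential is a strict `E`-function; `e` is an `E`-value (PROVED) -/

/-- `∑ zⁿ/n! = e^z`. [folklore] -/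
theorem eSeries_one_eq_exp : eSeries (fun _ => 1) = cexp := by
  funext z
  simp only [eSeries, one_mul]
  rw [Complex.exp_eq_exp_ℂ, NormedSpace.exp_eq_tsum_div]

/-- **`e^z` is a strict `E`-function** ("Offenbar ist die Exponentialfunktion eine E-Funktion"):
coefficients `aₙ = 1` (algebraic, conjugates of absolute value `1 ≤ 1^{n+1}`, denominators
`Dₙ = 1`), and `F′ − F = 0`. PROVED. [cite: Rivoal2024, Définition 5.2 and p. 227] -/
theorem isStrictEFunction_exp : IsStrictEFunction fun _ => 1 := by
  refine ⟨fun _ => isAlgebraic_one, ?_, ?_, ?_⟩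
  · -- the ODE `-F + F' = 0`
    refine ⟨1, ![-1, 1], ?_, ?_, ?_⟩
    · intro h
      have := congr_fun h 1
      simp at this
    · intro j k
      have hint : ∀ z : ℤ, IsAlgebraic ℚ ((z : ℂ)) := fun z => by
        simpa using isAlgebraic_algebraMap (R := ℚ) (A := ℂ) (z : ℚ)
      fin_cases j
      · simp only [Fin.zero_eta, Fin.isValue, Matrix.cons_val_zero, Polynomial.coeff_neg,
          Polynomial.coeff_one]
        split_ifs
        · simpa using hint (-1)
        · simpa using isAlgebraic_zero
      · simp only [Fin.mk_one, Fin.isValue, Matrix.cons_val_one, Matrix.cons_val_fin_one,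
          Polynomial.coeff_one]
        split_ifs
        · exact isAlgebraic_one
        · exact isAlgebraic_zero
    · intro z
      rw [eSeries_one_eq_exp]
      simp [Fin.sum_univ_two, iteratedDeriv_succ, iteratedDeriv_zero]
  · refine ⟨1, one_pos, fun n b hb => ?_⟩
    rw [minpoly.one ℚ ℂ, Polynomial.mem_rootSet] at hb
    have hb1 : b = 1 := by
      have := hb.2
      simp only [map_sub, Polynomial.aeval_X, Polynomial.aeval_one] at this
      exact sub_eq_zero.mp this
    simp [hb1]
  · refine ⟨fun _ => 1, 1, one_pos, fun n => ⟨le_rfl, by simp, fun m _ => ?_⟩⟩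
    simpa using isIntegral_one

/-- **`e` is an `E`-value** (PROVED): `e = F(1)` for the strict `E`-function `F = exp` — the
method reaches Hermite's theorem and Lindemann–Weierstrass ("Ce théorème est bien une
généralisation de celui de Lindemann–Weierstrass"). [cite: Rivoal2024, Théorème 5.10 and p. 234] -/
theorem exp_one_mem_eValues : cexp 1 ∈ eValues :=
  ⟨fun _ => 1, 1, isStrictEFunction_exp, isAlgebraic_one, by rw [eSeries_one_eq_exp]⟩

/-! ### 4. The printed expected scope: numbers believed not to be `E`-values

Registered OPEN CONJECTURES (CONVENTIONS §4): no `_holds` is to be expected for any of the four. -/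

/-- OPEN CONJECTURE — **`e + π` is not an `E`-value** (not the value at an algebraic point of a
strict `E`-function; the `E`-half of the printed exclusion, as a named conjectural statement).
POSED — as a belief, not a theorem — in T. Rivoal, *Les E-fonctions et G-fonctions de Siegel*
(X-UPS 2019, 2024), §5 p. 226: "disons d'ores et déjà que l'on pense que la constante d'Euler
`γ`, `Γ(1/5)`, `ln(π)`, `δ`, `e + π`, `eπ`, `e^e` et `π^e` ne sont des valeurs en un point
algébrique ni d'une `E`-fonction ni d'une `G`-fonction. Il est donc malheureusement probable
qu'aucun des théorèmes diophantiens cités ici sur ces fonctions ne s'applique à ces nombres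
individuellement"; the set of `E`-values is the printed `𝐄`, "l'ensemble de toutes les valeurs
des `E`-fonctions au sens strict en des points algébriques" (§8 Problème 6, p. 286), rendered by
`eValues`. [status: open] — neither a proof nor a disproof is in print, and a proof would settle
a printed open problem: since `ℚ̄ ⊆ eValues`, the statement implies the transcendence, a
fortiori the irrationality, of `e + π` (PROVED reductions
`ExpAddPiNotEValue.transcendental_exp_add_pi`, `ExpAddPiNotEValue.irrational_exp_add_pi` and
`ExpAddPiNotEValue.expOneAddPiIrrational` — the tree's registered open statement periods.S15
`Literature.NumberTheory.Transcendental.ExpOneAddPiIrrational` — in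
`EFunctionValuesAtAlgebraicPointsProofs.lean`), of which the same source prints "On ne sait pas
montrer non plus que les nombres `e + π` et `eπ` sont irrationnels, bien que l'on sache qu'au
moins l'un des deux est transcendant car `e` et `π` le sont" (§4 p. 204) and lists "la
transcendance de `e + π` et de `eπ`" among "plusieurs problèmes classiques encore ouverts"
contained in the conjecture `𝐄 ∩ 𝐆 = ℚ̄` (§8 Problème 10, p. 289). Conditionally, Schanuel's
conjecture implies that `e + π` is transcendental (`transcendental_exp_add_pi_of_schanuel`
below). Registered here as an OPEN statement
(CONVENTIONS §4: an open conjecture is a `def … : Prop`, never asserted), not as named-fact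
debt: no `ExpAddPiNotEValue_holds` is to be expected and users keep the explicit hypothesis
`(h : ExpAddPiNotEValue)`. Tenured prove-seat verdict (2026-08-15): `open-problem`,
transcription faithful; re-read against the source 2026-08-15, the verdict stands. The name is
kept (not renamed `…Conjecture`) because of its in-tree users (the dot-notation reductions
above). Statement unchanged.
[cite: Rivoal2024, §5 p. 226 (posed); §4 p. 204 and §8 Problème 10 p. 289 (open)] -/
@[conjecture] def ExpAddPiNotEValue : Prop :=
  ((Real.exp 1 + Real.pi : ℝ) : ℂ) ∉ eValues

/-- OPEN CONJECTURE — **`eπ` (the product `e · π`) is not an `E`-value** (not the value at an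
algebraic point of a strict `E`-function; the `E`-half of the printed exclusion). POSED — as a
belief, not a theorem — in [Rivoal2024], §5 p. 226: "l'on pense que la constante d'Euler `γ`,
`Γ(1/5)`, `ln(π)`, `δ`, `e + π`, `eπ`, `e^e` et `π^e` ne sont des valeurs en un point algébrique
ni d'une `E`-fonction ni d'une `G`-fonction" (the set `𝐄` of `E`-values: §8 Problème 6, p. 286;
here `eValues`). [status: open] — neither a proof nor a disproof is in print, and a proof would
settle a printed open problem: since `ℚ̄ ⊆ eValues`, the statement implies the transcendence, a
fortiori the irrationality, of `eπ` (PROVED reductions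
`ExpMulPiNotEValue.transcendental_exp_mul_pi`, `ExpMulPiNotEValue.irrational_exp_mul_pi` and
`ExpMulPiNotEValue.expOneMulPiIrrational` — the tree's registered open statement periods.S15
`Literature.NumberTheory.Transcendental.ExpOneMulPiIrrational` — in
`EFunctionValuesAtAlgebraicPointsProofs.lean`), of which the same source prints "On ne sait pas
montrer non plus que les nombres `e + π` et `eπ` sont irrationnels" (§4 p. 204; what is known is
that `e^π` is transcendental, Gel'fond, and that at least one of `e + π`, `eπ` is) and lists "la
transcendance de `e + π` et de `eπ` puisque `e, e⁻¹ ∈ 𝐄` et `π ∈ 𝐆`" among "plusieurs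
problèmes classiques encore ouverts" contained in the conjecture `𝐄 ∩ 𝐆 = ℚ̄` (§8 Problème 10,
p. 289). Conditionally, Schanuel's conjecture implies `eπ` is transcendental
(`transcendental_exp_mul_pi_of_schanuel` below). Registered here as an OPEN statement
(CONVENTIONS §4), not as named-fact debt: no `ExpMulPiNotEValue_holds` is to be expected and
users keep the explicit hypothesis `(h : ExpMulPiNotEValue)`. Tenured prove-seat verdict
(2026-08-15): `open-problem`, transcription faithful; re-read against the source 2026-08-15, the
verdict stands. The name is kept (in-tree users: the dot-notation reductions above). Statement
unchanged. [cite: Rivoal2024, §5 p. 226 (posed); §4 p. 204 and §8 Problème 10 p. 289 (open)] -/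
@[conjecture] def ExpMulPiNotEValue : Prop :=
  ((Real.exp 1 * Real.pi : ℝ) : ℂ) ∉ eValues

/-- OPEN CONJECTURE — **`e^e` is not an `E`-value** (not the value at an algebraic point of a
strict `E`-function; the `E`-half of the printed exclusion). POSED — as a belief, not a theorem —
in [Rivoal2024], §5 p. 226: "l'on pense que la constante d'Euler `γ`, `Γ(1/5)`, `ln(π)`, `δ`,
`e + π`, `eπ`, `e^e` et `π^e` ne sont des valeurs en un point algébrique ni d'une `E`-fonction ni
d'une `G`-fonction" (the set `𝐄` of `E`-values: §8 Problème 6, p. 286; here `eValues`).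
[status: open] — neither a proof nor a disproof is in print, and a proof would settle a printed
open problem: since `ℚ̄ ⊆ eValues`, the statement implies the transcendence, a fortiori the
irrationality, of `e^e` (PROVED reductions `ExpExpNotEValue.transcendental_exp_exp`,
`ExpExpNotEValue.irrational_exp_exp` in `EFunctionValuesAtAlgebraicPointsProofs.lean`), of which
the same source prints "On sait que `2^√2` et `e^π` sont transcendants (Kuzmin [96] et Gel'fond
[74] respectivement) mais on ne sait rien de `π^e`, `π^π` ou `e^e`" (§4 p. 204). Conditionally,
Schanuel's conjecture implies `e^e` is transcendental (`transcendental_exp_exp_of_schanuel`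
below). Registered here as an OPEN statement (CONVENTIONS §4), not as named-fact debt: no
`ExpExpNotEValue_holds` is to be expected and users keep the explicit hypothesis
`(h : ExpExpNotEValue)`; marked open (2026-08-15) on the same source pages and the same in-tree
reductions as its three siblings. The name is kept (in-tree users: the dot-notation reductions
above). Statement unchanged. [cite: Rivoal2024, §5 p. 226 (posed); §4 p. 204 (open)] -/
@[conjecture] def ExpExpNotEValue : Prop :=
  cexp (cexp 1) ∉ eValues

/-- OPEN CONJECTURE — **`π^e` is not an `E`-value** (not the value at an algebraic point of a
strict `E`-function; the `E`-half of the printed exclusion). POSED — as a belief, not a theorem —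
in [Rivoal2024], §5 p. 226: "l'on pense que la constante d'Euler `γ`, `Γ(1/5)`, `ln(π)`, `δ`,
`e + π`, `eπ`, `e^e` et `π^e` ne sont des valeurs en un point algébrique ni d'une `E`-fonction ni
d'une `G`-fonction" (the set `𝐄` of `E`-values: §8 Problème 6, p. 286; here `eValues`).
[status: open] — neither a proof nor a disproof is in print, and a proof would settle a printed
open problem: since `ℚ̄ ⊆ eValues`, the statement implies the transcendence, a fortiori the
irrationality, of `π^e` (PROVED reductions `PiPowExpNotEValue.transcendental_pi_pow_exp`,
`PiPowExpNotEValue.irrational_pi_pow_exp` in `EFunctionValuesAtAlgebraicPointsProofs.lean`), of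
which the same source prints "on ne sait rien de `π^e`, `π^π` ou `e^e`" (§4 p. 204).
Conditionally, Schanuel's conjecture implies `π^e` is transcendental
(`transcendental_pi_pow_exp_of_schanuel`, `EFunctionValuesAtAlgebraicPointsPiPowExpProofs.lean`).
Registered here as an OPEN statement (CONVENTIONS §4), not as named-fact debt: no
`PiPowExpNotEValue_holds` is to be expected and users keep the explicit hypothesis
`(h : PiPowExpNotEValue)`. Tenured prove-seat verdict (2026-08-15): `open-problem`, "an OPEN
CONJECTURE as printed, not dischargeable and not misstated"; re-read against the source
2026-08-15, the verdict stands. The name is kept (in-tree users: the dot-notation reductions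
above). Statement unchanged (`Real.pi ^ Real.exp 1`, the real power, cast to `ℂ`).
[cite: Rivoal2024, §5 p. 226 (posed); §4 p. 204 (open)] -/
@[conjecture] def PiPowExpNotEValue : Prop :=
  ((Real.pi ^ Real.exp 1 : ℝ) : ℂ) ∉ eValues

/-! ### 5. What the summit says about the same numbers (PROVED) -/

section Consequences

/-- A polynomial with a non-vanishing value is non-zero. [folklore] -/
private theorem mvPolynomial_ne_zero_of_aeval {σ : Type*} (P : MvPolynomial σ ℚ) (x : σ → ℚ)
    (h : MvPolynomial.aeval x P ≠ 0) : P ≠ 0 := fun h0 => h (by simp [h0])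

/-- A non-zero rational polynomial has a rational non-root. [folklore] -/
private theorem exists_eval_ne_zero {p : ℚ[X]} (hp : p ≠ 0) : ∃ r : ℚ, p.eval r ≠ 0 := by
  by_contra h
  push Not at h
  exact hp (Polynomial.funext (by simpa using h))

/-- If `x, y` are algebraically independent over `ℚ` then `x + y` is transcendental.
[folklore] -/
theorem transcendental_add_of_algebraicIndependent {x y : ℝ} (h : AlgebraicIndependent ℚ ![x, y]) :
    Transcendental ℚ (x + y) := by
  rintro ⟨p, hp0, hp⟩
  obtain ⟨r, hr⟩ := exists_eval_ne_zero hp0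
  set P : MvPolynomial (Fin 2) ℚ :=
    Polynomial.aeval (MvPolynomial.X 0 + MvPolynomial.X 1 : MvPolynomial (Fin 2) ℚ) p with hP
  have hPx : MvPolynomial.aeval ![x, y] P = 0 := by
    rw [hP, ← Polynomial.aeval_algHom_apply]
    simpa using hp
  have hP0 : P ≠ 0 := by
    refine mvPolynomial_ne_zero_of_aeval P ![r, 0] ?_
    have key := Polynomial.aeval_algHom_apply (MvPolynomial.aeval ![r, 0])
      (MvPolynomial.X 0 + MvPolynomial.X 1 : MvPolynomial (Fin 2) ℚ) p
    simp only [map_add, MvPolynomial.aeval_X, Matrix.cons_val_zero, Matrix.cons_val_one,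
      Matrix.cons_val_fin_one, add_zero, Polynomial.coe_aeval_eq_eval] at key
    rw [hP, ← key]
    exact hr
  exact hP0 (h (by rw [hPx, map_zero]))

/-- If `x, y` are algebraically independent over `ℚ` then `x y` is transcendental. [folklore] -/
theorem transcendental_mul_of_algebraicIndependent {x y : ℝ} (h : AlgebraicIndependent ℚ ![x, y]) :
    Transcendental ℚ (x * y) := by
  rintro ⟨p, hp0, hp⟩
  obtain ⟨r, hr⟩ := exists_eval_ne_zero hp0
  set P : MvPolynomial (Fin 2) ℚ :=
    Polynomial.aeval (MvPolynomial.X 0 * MvPolynomial.X 1 : MvPolynomial (Fin 2) ℚ) p with hP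
  have hPx : MvPolynomial.aeval ![x, y] P = 0 := by
    rw [hP, ← Polynomial.aeval_algHom_apply]
    simpa using hp
  have hP0 : P ≠ 0 := by
    refine mvPolynomial_ne_zero_of_aeval P ![r, 1] ?_
    have key := Polynomial.aeval_algHom_apply (MvPolynomial.aeval ![r, 1])
      (MvPolynomial.X 0 * MvPolynomial.X 1 : MvPolynomial (Fin 2) ℚ) p
    simp only [map_mul, MvPolynomial.aeval_X, Matrix.cons_val_zero, Matrix.cons_val_one,
      Matrix.cons_val_fin_one, mul_one, Polynomial.coe_aeval_eq_eval] at key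
    rw [hP, ← key]
    exact hr
  exact hP0 (h (by rw [hPx, map_zero]))

/-- **Schanuel ⟹ `e + π` is transcendental** (through the algebraic independence of `e` and `π`,
`expOnePiAlgebraicIndependent_of_schanuel`). [cite: Rivoal2024, §5 p. 226] -/
theorem transcendental_exp_add_pi_of_schanuel (hSC : ∀ n, Literature.NumberTheory.Transcendental.SchanuelRank n) :
    Transcendental ℚ (Real.exp 1 + Real.pi) :=
  transcendental_add_of_algebraicIndependent (expOnePiAlgebraicIndependent_of_schanuel hSC)

/-- **Schanuel ⟹ `eπ` is transcendental.** [cite: Rivoal2024, §5 p. 226] -/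
theorem transcendental_exp_mul_pi_of_schanuel (hSC : ∀ n, Literature.NumberTheory.Transcendental.SchanuelRank n) :
    Transcendental ℚ (Real.exp 1 * Real.pi) :=
  transcendental_mul_of_algebraicIndependent (expOnePiAlgebraicIndependent_of_schanuel hSC)

/-- **Schanuel ⟹ `e` and `e^e` are algebraically independent** (tuple `x = (1, e)`, which is
`ℚ`-linearly independent by Hermite; `ℚ(1, e, e, e^e) = ℚ(e, e^e)` has transcendence degree
`≥ 2`). [cite: Rivoal2024, §5 p. 226] -/
theorem algebraicIndependent_exp_expExp_of_schanuel (hSC : ∀ n, Literature.NumberTheory.Transcendental.SchanuelRank n) :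
    AlgebraicIndependent ℚ ![cexp 1, cexp (cexp 1)] := by
  have hli : LinearIndependent ℚ ![(1 : ℂ), cexp 1] :=
    linearIndependent_one_tau Literature.NumberTheory.Transcendental.transcendental_rat_cexp_one
  have h2 := hSC 2 _ hli
  have hset : Set.range ![(1 : ℂ), cexp 1] ∪ Set.range (cexp ∘ ![(1 : ℂ), cexp 1]) =
      insert (1 : ℂ) (Set.range ![cexp 1, cexp (cexp 1)]) := by
    ext w
    simp only [Set.mem_union, Set.mem_range, Function.comp_apply, Set.mem_insert_iff]
    constructor
    · rintro (⟨i, rfl⟩ | ⟨i, rfl⟩) <;> fin_cases i <;> simp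
    · rintro (rfl | ⟨i, rfl⟩)
      · exact Or.inl ⟨0, rfl⟩
      · fin_cases i
        · exact Or.inl ⟨1, rfl⟩
        · exact Or.inr ⟨1, rfl⟩
  have hadj : IntermediateField.adjoin ℚ (insert (1 : ℂ) (Set.range ![cexp 1, cexp (cexp 1)])) =
      IntermediateField.adjoin ℚ (Set.range ![cexp 1, cexp (cexp 1)]) := by
    refine le_antisymm ?_ (IntermediateField.adjoin.mono _ _ _ (Set.subset_insert _ _))
    rw [IntermediateField.adjoin_le_iff, Set.insert_subset_iff]
    exact ⟨one_mem _, IntermediateField.subset_adjoin _ _⟩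
  have heq : IntermediateField.adjoin ℚ
      (Set.range ![(1 : ℂ), cexp 1] ∪ Set.range (cexp ∘ ![(1 : ℂ), cexp 1])) =
      IntermediateField.adjoin ℚ (Set.range ![cexp 1, cexp (cexp 1)]) := by
    rw [hset, hadj]
  exact algebraicIndependent_of_le_trdeg_adjoin _
    (h2.trans_eq (IntermediateField.equivOfEq heq).trdeg_eq)

/-- **Schanuel ⟹ `e^e` is transcendental.** [cite: Rivoal2024, §5 p. 226] -/
theorem transcendental_exp_exp_of_schanuel (hSC : ∀ n, Literature.NumberTheory.Transcendental.SchanuelRank n) :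
    Transcendental ℚ (Real.exp (Real.exp 1)) := by
  have h := (algebraicIndependent_exp_expExp_of_schanuel hSC).transcendental 1
  simp only [Matrix.cons_val_one, Matrix.cons_val_fin_one] at h
  rw [show cexp (cexp 1) = ((Real.exp (Real.exp 1) : ℝ) : ℂ) by simp [Complex.ofReal_exp]] at h
  exact (transcendental_algebraMap_iff (A := ℂ) Complex.ofReal_injective).mp h

end Consequences

/-! ### 6. The catalogue declaration -/

/-- **Barrier (catalogue declaration): the `E`-function method lives at algebraic arguments.**
The declaration IS the method's scope theorem, the named fact `siegelShidlovskii_algIndep`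
(Siegel–Shidlovskii, algebraic-independence form; `eFunctionValuesAtAlgebraicPoints_iff`):
functional algebraic independence of strict `E`-functions transfers to their values ONLY at
algebraic `α` with `αT(α) ≠ 0`. Supporting PROVED theorems: `e` is an `E`-value
(`exp_one_mem_eValues`: the method proves Hermite / Lindemann–Weierstrass), while Schanuel's
conjecture implies the transcendence of `e + π`, `eπ`, `e^e` and the algebraic independence of
`e, e^e` (`transcendental_exp_add_pi_of_schanuel`, `transcendental_exp_mul_pi_of_schanuel`,
`algebraicIndependent_exp_expExp_of_schanuel`, `transcendental_exp_exp_of_schanuel`) — numbers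
printed as believed NOT to be values of `E`- (or `G`-) functions at algebraic points, recorded
as the conjectural named statements `ExpAddPiNotEValue`, `ExpMulPiNotEValue`,
`ExpExpNotEValue`, `PiPowExpNotEValue`.

BARRIER (D-0021).
- technique_class: siegel-shidlovskii e-functions g-functions pade-approximation linear-differential-equations values-at-algebraic-points beukers-andre-refinement
- explicit_class: the hypotheses of `siegelShidlovskii_algIndep` — strict `E`-functions `F₁, …, Fₙ` (`IsStrictEFunction`) with `Y′ = AY`, `A ∈ M_n(ℚ̄(z))`, evaluated at ALGEBRAIC `α` with `αT(α) ≠ 0`; its output concerns only `eValues` [cite: Rivoal2024, Définition 5.2 and Théorème 5.10].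
- blocks: the instances of `Schanuel` whose arguments are not algebraic: `x = (1, πi)` (transcendence of `e + π`, `eπ`; `transcendental_exp_add_pi_of_schanuel`, `transcendental_exp_mul_pi_of_schanuel`), `x = (1, e)` (`e, e^e` algebraically independent; `algebraicIndependent_exp_expExp_of_schanuel`), and `π^e` — "on pense que … `e + π`, `eπ`, `e^e` et `π^e` ne sont des valeurs en un point algébrique ni d'une `E`-fonction ni d'une `G`-fonction. Il est donc malheureusement probable qu'aucun des théorèmes diophantiens cités ici sur ces fonctions ne s'applique à ces nombres individuellement" [cite: Rivoal2024, §5 p. 226]; what the method does reach is the algebraic-argument part of Schanuel's conjecture: "En prenant `α = 1` … `deg tr_ℚ̄ ℚ̄(e^{α₁}, …, e^{αₙ}) = n`" (Lindemann–Weierstrass; `exp_one_mem_eValues`) [cite: Rivoal2024, Théorème 5.10 (p. 234)].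
- because: the theorem transfers FUNCTIONAL to NUMERICAL transcendence degree — "`deg tr_{ℚ̄(z)} ℚ̄(z)(F₁(z), …, Fₙ(z)) = deg tr_ℚ̄ ℚ̄(F₁(α), …, Fₙ(α))`" — only "pour tout `α ∈ ℚ̄` tel que `αT(α) ≠ 0`" [cite: Rivoal2024, Théorème 5.10], its engine being Siegel's arithmetic conditions on the Taylor coefficients (Déf. 5.2 (ii)–(iii)) and the functional equation substitute "une relation polynomiale sur `ℚ̄(z)` entre des `E`-fonctions … n'est rien d'autre qu'une relation linéaire … entre les diverses `E`-fonctions que l'on obtient en faisant des produits" [cite: Rivoal2024, p. 240]; without such structure "on se heurte rapidement à deux obstacles" (no explicit Padé approximants, no functional equation) [cite: Rivoal2024, §5 p. 226].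
- evasions_known: the optimal refinements "obtenu en 2006 par Beukers [23] pour les `E`-fonctions au sens strict, et par André [10] en 2014 pour les `E`-fonctions au sens large" — the optimal rank statement in Théorème 5.20 — stay at algebraic arguments `α ∈ ℚ̄` (resp. `α ∈ K`) [cite: Rivoal2024, footnote 11 (p. 240) and Théorèmes 5.19-5.21]; conditional/partial statements the method does give for non-`E`-values: "Au moins l'un des deux nombres `γ` ou `δ` est transcendant" [cite: Rivoal2024, Théorème 5.11]; `G`-functions "pourraient potentiellement s'appliquer un jour à `ζ(5)`, `G` et `Γ(1/5)⁵`, qui sont des valeurs en un point algébrique de `G`-fonctions" [cite: Rivoal2024, §5 p. 226].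
- scope_caveats: that `e + π`, `eπ`, `e^e`, `π^e` are not `E`- or `G`-values is printed as a belief ("on pense que"), not a theorem — the Lean statements `ExpAddPiNotEValue` etc. are conjectural named statements and only their `E`-half is formalised (`G`-functions are not defined here); `IsStrictEFunction` renders `σ(aₙ)` by the complex roots of `minpoly ℚ aₙ` and condition (i) with polynomial (cleared) coefficients; `siegelShidlovskii_algIndep` (= the catalogue declaration) is the maximal-degree case of the printed equality of transcendence degrees, for STRICT `E`-functions, with `T` any common denominator (so `αT(α) ≠ 0` is demanded for that `T`) and with algebraic independence over `ℚ̄` rendered by Mathlib's `AlgebraicIndependent (algebraicClosure ℚ ℂ)` (for functions: in the algebra `ℂ → ℂ`, family `(id, F₁, …, Fₙ)`); `eSeries` is the formal sum `∑ aₙzⁿ/n!` as a `tsum` (junk value `0` where divergent, which condition (ii) excludes in print).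
- status: established for the scope theorem [cite: Rivoal2024, Théorème 5.10]; the exclusion of `e + π`, `eπ`, `e^e`, `π^e` from `E`-values is conjectural [cite: Rivoal2024, §5 p. 226]. -/
def EFunctionValuesAtAlgebraicPoints : Prop :=
  siegelShidlovskii_algIndep

/-- The barrier declaration is the Siegel–Shidlovskii scope theorem
(`siegelShidlovskii_algIndep`). [folklore] -/
theorem eFunctionValuesAtAlgebraicPoints_iff :
    EFunctionValuesAtAlgebraicPoints ↔ siegelShidlovskii_algIndep :=
  Iff.rfl

end Literature.Barriers.Schanuel

end
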